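import Summits.ABC.IUTFork.Cor312ThetaSideSlotTransportK
import Summits.ABC.IUTFork.Cor312ThetaSideOrbitHullM
import HarnessLib

/-!
# [IUTchIII] Cor. 3.12 at the `K`-level sharp setting: abc-iut-s2-p7 gen 0's global content bound (p438921) WITH ITS `hslot` BINDER
# DISCHARGED at the genuine datum — the Θ-side of hΘ on the line of record v6K/v7K up to the Galois descent of the right-hand side

PROOF-ONLY support file (D-0012; no definitions, no `Prop` facts) of the abc-iut cell (R2 S-chain team, seat abc-iut-s2-p7 gen 2, TARGET #2
`hΘ`; sequel of `Cor312ThetaSideSlotTransportK`, split BY NAME with abc-iut-s2-p6 gen 2's assembly `Cor312ThetaSideClosedK`). TAKES NO SIDE on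
[IUTchIII] Cor. 3.12. In the currency of the assembly:

* `contentFamily_perm` — the (Ind1)-SYMMETRY of abc-iut-c312-3's EXACT content family `m_gen` of the slot unions of the genuine input
  `volumeInputOf D r` (binder shape `hmgen` = the body of `ThetaVolumeInput.exists_contentFamily`): `m_gen(p,i,w⃗∘σ) = m_gen(p,i,w⃗)` at every
  support prime (abc-iut-s2-p7 gen 0 `Cor312Vol.content_slotUnion_perm`: permuted slot unions have the same content; contents are unique);
* **`slot_subset_of_contentFamily`** — the `hslot` binder of p438921 (`negLogTheta_settingPrVolSharp_le_sum_content_hull`) VERBATIM for the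
  family `m_K(p,i,e) := m_gen(p,i,v⃗(e))` (`v⃗(e)` = the places of `F_mod` below the tuple `e` of places of `K`) on any finite `Tp ⊆ T(I)`, for
  EVERY realising Θ-idele `t` over `K` (`Cor312Prov.iota_smul_normalizedPacket_subset_of_section`);
* **`negLogTheta_settingPrVolSharp_pilotDataOfK_le_sum_content_below`** — p438921 with `hslot` DISCHARGED: for initial Θ-data `D`, idele data
  `r`, ANY realising Θ-idele `t` (`ht0`, `hT` — the binders of v7K's `hΘ`; `‖t‖ = 1` off `S` follows, `norm_eq_one_of_realising_of_not_mem`), any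
  q-idele `tq` (`htq0`, `htq1`), any finite set `Tp` of primes inside `T(I)` containing the prime divisors of `2·disc K` and the primes under
  `S_K`, any `A ≥ 0`:
  `−|log(Θ)|(settingPrVolSharp (pilotDataOfK D K) …) ≤ ↑(Σ_{p∈Tp} (1/ℓ⋆)·Σ_i Σ_e Pr_K(e)·(−m_gen(p,i,v⃗(e))·log p + log μ̄_e(hull(log_p R_e^×))) + A)`.
What is left for the line-of-record binder `hΘ` (abc-iut-s2-p6's `Cor312ThetaSideClosedK`): the Galois descent of the right-hand side to the
section (abc-iut-w5-d056 `sum_weightPr_mul_contentHull_eq_placeSection`; `m_K` is Galois-invariant by construction since `v⃗(g•e) = v⃗(e)`,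
`finBelow_smul`) and abc-iut-c312-3's `negLogThetaNonarch_eq_of_content` with `Tp := T(I)` and `A := archLogTheta l`.

[cite: Mochizuki2012, IUTchIII Cor. 3.12 p. 173–174] [cite: Mochizuki2012, IUTchIV Thm. 1.10 Steps (v)–(viii) p. 27–30]
[cite: DupuyHilado2025, §3.6, §4.7, §4.12] [claim: Mochizuki2012, status: disputed] for every quoted construction. HONEST FRAMING: an UPPER
bound on OUR typed `−|log(Θ)|` at the genuine `K`-level sharp setting by OUR typed Dupuy–Hilado content closed form; nothing here asserts or
denies Cor. 3.12 for any initial Θ-data or takes a side on any author; typed ≠ proved; instantiated ≠ endorsed.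
-/

noncomputable section

open Set Function NumberField IsDedekindDomain
open scoped Pointwise

namespace Summit.ABC.IUTFork.Cor312Prov

open Cor312 Cor312Vol Literature.IUT.LogThetaLattice Literature.IUT.LogVolume
  Literature.IUT.HodgeTheaters Literature.IUT.LogVolume.ThetaData Literature.NumberTheory.NumberFields
open Thm311.Real hiding finBelow

variable {F K Fbar : Type} [Field F] [NumberField F] [Field K] [NumberField K] [Algebra F K] [Field Fbar]
  [Algebra F Fbar] [Algebra K Fbar] {E : WeierstrassCurve F} [E.IsElliptic] {l : ℕ} {Pb : BadPlacePredicates K}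
  (D : InitialThetaData F K Fbar E l Pb)

section ContentFamily

variable (r : IdeleData D)
  (mgen : (p : ℕ) → (i : Fin (volumeInputOf D r).lstar) → (Fin ((i : ℕ) + 1 + 1) → placesOver (fieldOfModuli E) p) → ℤ)
  (hmgen : ∀ (p : ℕ) [hp : Fact p.Prime], p ∈ (volumeInputOf D r).supportPrimes →
    ∀ (i : Fin (volumeInputOf D r).lstar) (e : Fin ((i : ℕ) + 1 + 1) → placesOver (fieldOfModuli E) p),
    (⋃ a : Fin ((i : ℕ) + 1 + 1), iota p (fun b => ((volumeInputOf D r).σ.localFieldFamily p hp.out).k (e b)) a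
          ((volumeInputOf D r).tΘ p hp.out i (e a) : ((volumeInputOf D r).σ.localFieldFamily p hp.out).k (e a)) •
        (normalizedPacket p (fun b => ((volumeInputOf D r).σ.localFieldFamily p hp.out).k (e b)) :
          Set (PacketAlgebra p (fun b => ((volumeInputOf D r).σ.localFieldFamily p hp.out).k (e b))))) ⊆
      ((p : ℚ_[p]) ^ mgen p i e) • (logPacket p (fun b => ((volumeInputOf D r).σ.localFieldFamily p hp.out).k (e b)) :
          Set (PacketAlgebra p (fun b => ((volumeInputOf D r).σ.localFieldFamily p hp.out).k (e b)))) ∧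
    ¬ (⋃ a : Fin ((i : ℕ) + 1 + 1), iota p (fun b => ((volumeInputOf D r).σ.localFieldFamily p hp.out).k (e b)) a
          ((volumeInputOf D r).tΘ p hp.out i (e a) : ((volumeInputOf D r).σ.localFieldFamily p hp.out).k (e a)) •
        (normalizedPacket p (fun b => ((volumeInputOf D r).σ.localFieldFamily p hp.out).k (e b)) :
          Set (PacketAlgebra p (fun b => ((volumeInputOf D r).σ.localFieldFamily p hp.out).k (e b))))) ⊆
      ((p : ℚ_[p]) ^ (mgen p i e + 1)) • (logPacket p (fun b => ((volumeInputOf D r).σ.localFieldFamily p hp.out).k (e b)) :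
          Set (PacketAlgebra p (fun b => ((volumeInputOf D r).σ.localFieldFamily p hp.out).k (e b)))))

include hmgen in
/-- **(Ind1)-symmetry of the EXACT content family of a genuine input**: abc-iut-c312-3's content family `m_gen` of the slot unions of
`volumeInputOf D r` (`ThetaVolumeInput.exists_contentFamily`, the binder shape `hmgen`) is invariant under permutations of the tuple at every
support prime (abc-iut-s2-p7 gen 0 `Cor312Vol.content_slotUnion_perm`: the slot union of the permuted family has the same content, and contents
are unique). [cite: DupuyHilado2025, §4.7, §4.12] [cite: Mochizuki2012, IUTchIV Thm. 1.10 Step (v) p. 27–28] -/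
theorem contentFamily_perm {p : ℕ} [hp : Fact p.Prime] (hpT : p ∈ (volumeInputOf D r).supportPrimes)
    (i : Fin (volumeInputOf D r).lstar) (σ : Equiv.Perm (Fin ((i : ℕ) + 1 + 1)))
    (w : Fin ((i : ℕ) + 1 + 1) → placesOver (fieldOfModuli E) p) :
    mgen p i (w ∘ σ) = mgen p i w :=
  Cor312Vol.content_slotUnion_perm p (fun b => ((volumeInputOf D r).σ.localFieldFamily p hp.out).k (w b)) σ
    (fun b => ((volumeInputOf D r).tΘ p hp.out i (w b) : ((volumeInputOf D r).σ.localFieldFamily p hp.out).k (w b)))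
    (hmgen p hpT i (w ∘ σ)).1 (hmgen p hpT i (w ∘ σ)).2 (hmgen p hpT i w).1 (hmgen p hpT i w).2

variable
  (t : ∀ (pp : Nat.Primes) (_ : Fin (pilotDataOfK D K).lstar) (x : (thetaIndex (pilotDataOfK D K)).Fibre (.inr pp)),
    haveI : Fact (pp : ℕ).Prime := ⟨pp.2⟩; kOf (pilotDataOfK D K) pp.1 x)

include hmgen in
/-- **The `hslot` binder of p438921 for the family `m_K(p,i,e) := m_gen(p,i,v⃗(e))`** (`v⃗(e)` = the places of `F_mod` below the tuple `e` of
places of `K`), on any finite set `Tp` of primes inside abc-iut-S2's support `T(I)`: for every realising Θ-idele `t` over `K`, every `p ∈ Tp`,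
`i`, tuple `e` and slot `a`, `ι_a(t_{i,e_a})·(R_e)^∼ ⊆ p^{m_gen(p,i,v⃗(e))}·log_p(R_e^×)` (`iota_smul_normalizedPacket_subset_of_section` at the content
containment `hmgen`). [cite: Mochizuki2012, IUTchIV Thm. 1.10 Step (v) p. 27–28] [cite: DupuyHilado2025, §4.12] -/
theorem slot_subset_of_contentFamily {logv : PadicLogs K} (hlog : LogvAnalytic logv) (ht0 : ∀ pp i x, t pp i x ≠ 0)
    (hT : ∀ (pp : Nat.Primes) (i : Fin (pilotDataOfK D K).lstar) (x : (thetaIndex (pilotDataOfK D K)).Fibre (.inr pp)),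
      haveI : Fact (pp : ℕ).Prime := ⟨pp.2⟩
      Real.log ‖t pp i x‖ = -((pilotDataOfK D K).thetaPilot i (placeOf (pilotDataOfK D K) pp.1 x)) *
        logNorm K (placeOf (pilotDataOfK D K) pp.1 x) / localDegree K (placeOf (pilotDataOfK D K) pp.1 x))
    (Tp : Finset Nat.Primes) (hTp : ∀ pp ∈ Tp, (pp : ℕ) ∈ (volumeInputOf D r).supportPrimes) :
    ∀ pp ∈ Tp, ∀ (i : Fin (thetaIndex (pilotDataOfK D K)).lstar)
      (e : (thetaIndex (pilotDataOfK D K)).Caps (Setting.labelSucc i) → (thetaIndex (pilotDataOfK D K)).Fibre (.inr pp))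
      (a : (thetaIndex (pilotDataOfK D K)).Caps (Setting.labelSucc i)),
      haveI : Fact (pp : ℕ).Prime := ⟨pp.2⟩
      iota pp.1 ((presAt (pilotDataOfK D K) hlog pp).kk e) a (t pp i (e a)) •
          (normalizedPacket pp.1 ((presAt (pilotDataOfK D K) hlog pp).kk e) :
            Set ((presAt (pilotDataOfK D K) hlog pp).X e)) ⊆
        (((pp : ℕ) : ℚ_[pp]) ^ mgen pp.1 i (fun b =>
            ⟨finBelow (fieldOfModuli E) K (placeOf (pilotDataOfK D K) pp.1 (e b)),
              finBelow_mem_placesOver (fieldOfModuli E) K (placeOf_mem (pilotDataOfK D K) pp.1 (e b))⟩)) •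
          (logPacket pp.1 ((presAt (pilotDataOfK D K) hlog pp).kk e) : Set ((presAt (pilotDataOfK D K) hlog pp).X e)) := by
  intro pp hpp i e a
  haveI : Fact (pp : ℕ).Prime := ⟨pp.2⟩
  exact iota_smul_normalizedPacket_subset_of_section D t hlog r ht0 hT pp i e (hmgen pp.1 (hTp pp hpp) i _).1 a

variable {logv : PadicLogs K} (hlog : LogvAnalytic logv) (M : Type) [Field M] [NumberField M]
  (archPk : ∀ (j : (thetaIndex (pilotDataOfK D K)).Label) (vQ : (thetaIndex (pilotDataOfK D K)).VQ),
    Set ((logShellsDH (pilotDataOfK D K) logv).Packet j vQ))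
  (archSub : ∀ (j : (thetaIndex (pilotDataOfK D K)).Label) (v : (thetaIndex (pilotDataOfK D K)).V),
    Set ((logShellsDH (pilotDataOfK D K) logv).Packet j ((thetaIndex (pilotDataOfK D K)).over v)))
  (Ψ : ℤ → ∀ v : (thetaIndex (pilotDataOfK D K)).V, v ∈ (thetaIndex (pilotDataOfK D K)).Vbad →
    Set ((logShellsDH (pilotDataOfK D K) logv).StarPacket v))
  (act : ℤ → ∀ v : (thetaIndex (pilotDataOfK D K)).V, v ∈ (thetaIndex (pilotDataOfK D K)).Vbad →
    (logShellsDH (pilotDataOfK D K) logv).StarPacket v → Module.End ℚ ((logShellsDH (pilotDataOfK D K) logv).StarPacket v))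
  (Mmod : ℤ → ∀ j : (thetaIndex (pilotDataOfK D K)).LabelStar, Set ((logShellsDH (pilotDataOfK D K) logv).GlobalPacket j.1))
  (region : ℤ → ∀ j : (thetaIndex (pilotDataOfK D K)).LabelStar, FinDivisor M → ∀ vQ : (thetaIndex (pilotDataOfK D K)).VQ,
    Set ((logShellsDH (pilotDataOfK D K) logv).Packet j.1 vQ))
  (n : ℤ) {HT : Type} {LogLink : HT → HT → Type} {IsFull : ∀ {s t : HT}, LogLink s t → Prop}
  (lat : LGPGaussianLogThetaLattice LogLink IsFull)
  {Frd : Type} {IsoF : Frd → Frd → Type} {Ob : Frd → Type} {realify : Frd → Frd} {Strip : Type}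
  {IsoS : Strip → Strip → Type}
  {Mv : ∀ v : (thetaIndex (pilotDataOfK D K)).V, v ∈ (thetaIndex (pilotDataOfK D K)).Vbad → Type} [∀ v h, Monoid (Mv v h)]
  (sig : GlobalLGPFrobenioidSignature (thetaIndex (pilotDataOfK D K)).lstar (thetaIndex (pilotDataOfK D K)).V
    (· ∈ (thetaIndex (pilotDataOfK D K)).Vbad) Frd IsoF Ob realify Strip IsoS Mv)
  (split : SplittingMonoids Mv) {ObΔ : Type}
  {N : ∀ v : (thetaIndex (pilotDataOfK D K)).V, v ∈ (thetaIndex (pilotDataOfK D K)).Vbad → Type} [∀ v h, Monoid (N v h)]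
  (qData : QPilotData ObΔ N)
  (tq : ∀ (pp : Nat.Primes) (x : (thetaIndex (pilotDataOfK D K)).Fibre (.inr pp)),
    haveI : Fact (pp : ℕ).Prime := ⟨pp.2⟩; kOf (pilotDataOfK D K) pp.1 x)

include hmgen in
/-- **abc-iut-s2-p7 gen 0's global content bound (p438921) WITH `hslot` DISCHARGED, at the genuine `K`-level sharp setting.** For initial
Θ-data `D` with idele data `r`, ANY realising Θ-idele `t` over `K` (`ht0`, `hT` — the binders of v7K's `hΘ`; `‖t‖ = 1` off `S` follows) and ANY
q-idele `tq` (`htq0`, `htq1`), abc-iut-c312-3's exact content family `m_gen` of `volumeInputOf D r` (`hmgen`), any finite set `Tp` of primes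
inside `T(I)` containing the prime divisors of `2·disc K` and the primes under `S_K`, and any `A ≥ 0`:
`−|log(Θ)|(settingPrVolSharp (pilotDataOfK D K) …) ≤ ↑(Σ_{p∈Tp} (1/ℓ⋆)·Σ_i Σ_{e} Pr_K(e)·(−m_gen(p,i,v⃗(e))·log p + log μ̄_e(hull(log_p R_e^×))) + A)`.
The capsule symmetry of `m_K(e) := m_gen(v⃗(e))` is `contentFamily_perm`; `hslot` is `slot_subset_of_contentFamily`. What is left for the
line-of-record `hΘ`: descend the right-hand side to the section (abc-iut-w5-d056 `sum_weightPr_mul_contentHull_eq_placeSection`) and read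
abc-iut-c312-3's `negLogThetaNonarch_eq_of_content`. [cite: Mochizuki2012, IUTchIV Thm. 1.10 Steps (v)–(viii) p. 27–30]
[cite: DupuyHilado2025, §3.6, §4.12] -/
theorem negLogTheta_settingPrVolSharp_pilotDataOfK_le_sum_content_below (ht0 : ∀ pp i x, t pp i x ≠ 0)
    (hT : ∀ (pp : Nat.Primes) (i : Fin (pilotDataOfK D K).lstar) (x : (thetaIndex (pilotDataOfK D K)).Fibre (.inr pp)),
      haveI : Fact (pp : ℕ).Prime := ⟨pp.2⟩
      Real.log ‖t pp i x‖ = -((pilotDataOfK D K).thetaPilot i (placeOf (pilotDataOfK D K) pp.1 x)) *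
        logNorm K (placeOf (pilotDataOfK D K) pp.1 x) / localDegree K (placeOf (pilotDataOfK D K) pp.1 x))
    (htq0 : ∀ pp x, tq pp x ≠ 0)
    (htq1 : ∀ (pp : Nat.Primes) (x : (thetaIndex (pilotDataOfK D K)).Fibre (.inr pp)),
      haveI : Fact (pp : ℕ).Prime := ⟨pp.2⟩; placeOf (pilotDataOfK D K) pp.1 x ∉ (pilotDataOfK D K).S → ‖tq pp x‖ = 1)
    (Tp : Finset Nat.Primes) (hTp : ∀ pp ∈ Tp, (pp : ℕ) ∈ (volumeInputOf D r).supportPrimes)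
    (hTp' : ∀ pp : Nat.Primes,
      ((pp : ℕ) ∣ 2 * (NumberField.discr K).natAbs ∨ ∃ v ∈ (pilotDataOfK D K).S, ((pp : ℕ) : 𝓞 K) ∈ v.asIdeal) → pp ∈ Tp)
    {A : ℝ} (hA : 0 ≤ A) :
    (settingPrVolSharp (pilotDataOfK D K) hlog M archPk archSub Ψ act Mmod region n lat sig split qData tq t htq0
        htq1).negLogTheta ≤
      ((∑ pp ∈ Tp, (1 / ((thetaIndex (pilotDataOfK D K)).lstar : ℝ)) * ∑ i : Fin (thetaIndex (pilotDataOfK D K)).lstar,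
          (haveI : Fact (pp : ℕ).Prime := ⟨pp.2⟩
           ∑ e : (presAt (pilotDataOfK D K) hlog pp).toLocalPieces.E (Setting.labelSucc i),
            weightPr (pilotDataOfK D K) pp.1 (Setting.labelSucc i) e *
              (-(mgen pp.1 i (fun b =>
                  ⟨finBelow (fieldOfModuli E) K (placeOf (pilotDataOfK D K) pp.1 (e b)),
                    finBelow_mem_placesOver (fieldOfModuli E) K (placeOf_mem (pilotDataOfK D K) pp.1 (e b))⟩) * Real.log pp) +
                packetLogμ pp.1 ((presAt (pilotDataOfK D K) hlog pp).kk e)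
                  (packetHull pp.1 ((presAt (pilotDataOfK D K) hlog pp).kk e)
                    (logPacket pp.1 ((presAt (pilotDataOfK D K) hlog pp).kk e) :
                      Set ((presAt (pilotDataOfK D K) hlog pp).X e))))) + A : ℝ) :
        WithTop ℝ) := by
  classical
  -- the `K`-level content family, `0` off `Tp` (where the local Θ-term vanishes anyway)
  let mK : ∀ (pp : Nat.Primes) (i : Fin (thetaIndex (pilotDataOfK D K)).lstar),
      ((thetaIndex (pilotDataOfK D K)).Caps (Setting.labelSucc i) → (thetaIndex (pilotDataOfK D K)).Fibre (.inr pp)) → ℤ :=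
    fun pp i e => if pp ∈ Tp then
      haveI : Fact (pp : ℕ).Prime := ⟨pp.2⟩
      mgen pp.1 i (fun b => ⟨finBelow (fieldOfModuli E) K (placeOf (pilotDataOfK D K) pp.1 (e b)),
        finBelow_mem_placesOver (fieldOfModuli E) K (placeOf_mem (pilotDataOfK D K) pp.1 (e b))⟩) else 0
  have hmK : ∀ (pp : Nat.Primes) (i : Fin (thetaIndex (pilotDataOfK D K)).lstar)
      (σ : Equiv.Perm ((thetaIndex (pilotDataOfK D K)).Caps (Setting.labelSucc i)))
      (e : (thetaIndex (pilotDataOfK D K)).Caps (Setting.labelSucc i) → (thetaIndex (pilotDataOfK D K)).Fibre (.inr pp)),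
      mK pp i (e ∘ σ) = mK pp i e := by
    intro pp i σ e
    by_cases hpp : pp ∈ Tp
    · haveI : Fact (pp : ℕ).Prime := ⟨pp.2⟩
      simp only [mK, if_pos hpp]
      exact contentFamily_perm D r mgen hmgen (hTp pp hpp) i σ (fun b =>
        ⟨finBelow (fieldOfModuli E) K (placeOf (pilotDataOfK D K) pp.1 (e b)),
          finBelow_mem_placesOver (fieldOfModuli E) K (placeOf_mem (pilotDataOfK D K) pp.1 (e b))⟩)
    · simp only [mK, if_neg hpp]
  have ht1 : ∀ (pp : Nat.Primes) (i : Fin (pilotDataOfK D K).lstar) (x : (thetaIndex (pilotDataOfK D K)).Fibre (.inr pp)),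
      haveI : Fact (pp : ℕ).Prime := ⟨pp.2⟩; placeOf (pilotDataOfK D K) pp.1 x ∉ (pilotDataOfK D K).S → ‖t pp i x‖ = 1 :=
    fun pp i x hx => norm_eq_one_of_realising_of_not_mem D t ht0 hT pp i x hx
  have key := negLogTheta_settingPrVolSharp_le_sum_content_hull (pilotDataOfK D K) hlog M archPk archSub Ψ act Mmod region n
    lat sig split qData t tq ht0 ht1 htq0 htq1 Tp hTp' mK hmK (fun pp hpp i e a => by
      haveI : Fact (pp : ℕ).Prime := ⟨pp.2⟩
      have h := slot_subset_of_contentFamily D r mgen hmgen t hlog ht0 hT Tp hTp pp hpp i e a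
      simp only [mK, if_pos hpp]
      exact h) hA
  refine le_trans key (le_of_eq ?_)
  congr 1
  congr 1
  refine Finset.sum_congr rfl fun pp hpp => ?_
  congr 1
  refine Finset.sum_congr rfl fun i _ => ?_
  refine Finset.sum_congr rfl fun e _ => ?_
  simp only [mK, if_pos hpp]

end ContentFamily

end Summit.ABC.IUTFork.Cor312Prov

end
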